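import Summits.CriticalPhenomena.PercolationContinuityZ3.Theorems.PercNearOneGluingNoHeavyLowerTailTerminalEdgeStepXiHqtLeFive
import Mathlib.Tactic.Ring
import HarnessLib

/-!
# The apex-edge Bernstein pieces of `H_{q+t}` and AG⁺ RESTRICT to the rows themselves on the `y`-isolated face — a certificate no-go by restriction

Support file (prover prim-l12-p1 gen 2, P1 switching-certificate lane; `--supports stmt-CriticalPhenomena-4575`).  No named facts, no sorries,
pure ring identities.

The terminal-edge induction for the open cubic three-point row `H_{q+t} = (q+t)(qt − e₂(u)) − e₃(u)` (`CubicThreePointTerminal.Hqt`;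
`Hmax ⇒ H_{q+t} ⇒ AG⁺ ⇒ SHK3⁺`) asks for the two four-point inequalities (BH1),(BH2): `hqtB₁, hqtB₂ ≥ 0` (prim-bnk-1,
`…TerminalEdgeStepXiHqtLeFive`; driver `CubicThreePointStep.hqt_of_stepHypH` of prim-facecert).  It was asked (prim-ineq-gen-1 g6, 2026-08-20)
whether the three- or four-copy switching-certificate LPs that certified the SHK3⁺ pieces `threeB₁, threeB₂` could certify (BH1),(BH2) although
`H_{q+t}` itself has no certificate in those classes.  The identities below answer this WITHOUT computation:

* `hqtB₁_transition_zero`, `hqtB₂_transition_zero`: at vanishing transition masses `α₁ = α₂ = β₁ = β₂ = β₃ = 0` — exactly the laws of the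
  four-pointed graphs in which the apex partner `y` carries no edge — `hqtB₁ = hqtB₂ = 3·Hqt`; likewise `xiB₁ = xiB₂ = 3·Ξ` for AG⁺.
* CONSEQUENCE (meta, recorded here as the docstring of `hqtB_face_restriction`): let `𝓛` be any certificate language for four-pointed graphs that is
  closed under restriction to the `y`-isolated face (every k-copy switching language with X-rooted or multi-root exploration programs and potentials
  read on terminal-partition types or event atoms is: a step exploring `cl(y) = {y}` is the identity, and type/atom potentials restrict to the five
  `y`-singleton types).  A certificate of (BH1) or (BH2) in `𝓛` restricts to a certificate of `3·H_{q+t} ≥ 0` in the three-terminal restriction of `𝓛`.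
  Hence (BH1),(BH2) have NO certificate in any class whose three-terminal restriction was shown LP-infeasible for `H_{q+t}`: three copies with
  pools X2/X3 and type potentials (prim-l12-p1 gen 0), three copies XI3+out / +full / +theorem rows {F, AG⁺, T_inc} + GZ/K3 cones (prim-ineq-prove-3
  g7, kit j084443, j085162–5), four copies X0/X0d3 and five copies X0d3 (prim-ineq-prove-3 g6).  The Bernstein route to `H_{q+t}` is therefore never
  cheaper than the direct route in such languages; what remains are languages that are NOT restriction-closed (e.g. certificates using the forced
  apex edge `{a,y}` of the contracted side `G/e` as data) or non-certificate proofs.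
-/

namespace Summit.CriticalPhenomena.PercolationContinuityZ3.Theorems.TerminalEdgeStep

open CubicThreePointTerminal

variable {R : Type*} [CommRing R]

/-- On the `y`-isolated face (all five transition masses zero) the first Bernstein piece of `H_{q+t}` is `3·H_{q+t}`. [this work] -/
theorem hqtB₁_transition_zero (q u₁ u₂ u₃ t : R) :
    hqtB₁ q u₁ u₂ u₃ t 0 0 0 0 0 = 3 * Hqt q u₁ u₂ u₃ t := by
  simp only [hqtB₁, Hqt]; ring

/-- On the `y`-isolated face the second Bernstein piece of `H_{q+t}` is `3·H_{q+t}`. [this work] -/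
theorem hqtB₂_transition_zero (q u₁ u₂ u₃ t : R) :
    hqtB₂ q u₁ u₂ u₃ t 0 0 0 0 0 = 3 * Hqt q u₁ u₂ u₃ t := by
  simp only [hqtB₂, Hqt]; ring

/-- On the `y`-isolated face the first Bernstein piece of AG⁺ is `3·Ξ`. [this work] -/
theorem xiB₁_transition_zero (q u₁ u₂ u₃ t : R) :
    xiB₁ q u₁ u₂ u₃ t 0 0 0 0 0 = 3 * Xi q u₁ u₂ u₃ t := by
  simp only [xiB₁, Xi]; ring

/-- On the `y`-isolated face the second Bernstein piece of AG⁺ is `3·Ξ`. [this work] -/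
theorem xiB₂_transition_zero (q u₁ u₂ u₃ t : R) :
    xiB₂ q u₁ u₂ u₃ t 0 0 0 0 0 = 3 * Xi q u₁ u₂ u₃ t := by
  simp only [xiB₂, Xi]; ring

/-- **Face restriction** (the no-go carrier): if both Bernstein pieces of `H_{q+t}` are nonnegative at EVERY choice of transition masses
(in particular at zero), then `H_{q+t} ≥ 0` at the base law — over any ordered commutative ring containing `3⁻¹`, here `ℝ`.  So any proof or
certificate of (BH1) alone, uniform in the transition data, contains a proof of the row `H_{q+t} ≥ 0` for the three-terminal restriction. [this work] -/
theorem hqtB_face_restriction {q u₁ u₂ u₃ t : ℝ}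
    (h : ∀ α₁ α₂ β₁ β₂ β₃ : ℝ, 0 ≤ hqtB₁ q u₁ u₂ u₃ t α₁ α₂ β₁ β₂ β₃) : 0 ≤ Hqt q u₁ u₂ u₃ t := by
  have h0 := h 0 0 0 0 0
  rw [hqtB₁_transition_zero] at h0
  linarith

/-- The same for AG⁺: (BΞ1) uniform in the transition data forces `Ξ ≥ 0` at the base law. [this work] -/
theorem xiB_face_restriction {q u₁ u₂ u₃ t : ℝ}
    (h : ∀ α₁ α₂ β₁ β₂ β₃ : ℝ, 0 ≤ xiB₁ q u₁ u₂ u₃ t α₁ α₂ β₁ β₂ β₃) : 0 ≤ Xi q u₁ u₂ u₃ t := by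
  have h0 := h 0 0 0 0 0
  rw [xiB₁_transition_zero] at h0
  linarith

end Summit.CriticalPhenomena.PercolationContinuityZ3.Theorems.TerminalEdgeStep
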